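import Summits.CriticalPhenomena.PercolationContinuityZ3.Theorems.Transplant.SqShadowFact2Reduction
import Summits.CriticalPhenomena.PercolationContinuityZ3.Theorems.Transplant.SqShadowEq12
import HarnessLib

/-!
# SQUARE SHADOWS — the PLANAR case: an INJECTIVE square shadow makes DST's exceptional event `𝒳` empty, the routing node vacuous, and gives `θ_v(p_c) = 0` for every
# connected planar `D₄`-lattice drawn on `ℤ²` with a.s. uniqueness (square twin of «HexShadowInjective»)

builds on p205010 (kernel theorem, internal audit signed; external expert review pending) — NOT used in this file.  Lane `prim-bschramm`, seat `prim-bschramm-p2` (gen 42; class C1b;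
memo `HOME/bschramm/P2-LATTICES.md` §148); helper file (`--supports stmt-CriticalPhenomena-4575 --as helper`).
* `not_mem_evX_of_injective` (two open paths whose shadows share a point share a vertex, so the crossing step gives `C`), `sqLocatedSurgeries_of_injective` (vacuous),
  `sqGluing_of_injective`, **`theta_criticalProb_eq_zero_of_injective`** (`G` connected, a.s. uniqueness, `sh` injective ⇒ `θ_v(p_c) = 0`): e.g. `ℤ²` itself WITHOUT RSW theory, the
  truncated-square and other planar `D₄`-lattices realised on `ℤ²`.
[cite: DuminilCopinSidoraviciusTassion2016, Thm. 1, Lemma 6, §2.3] [cite: BenjaminiSchramm1996, Conj. 4 / Question 3]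
-/

noncomputable section

namespace Summit.CriticalPhenomena.PercolationContinuityZ3.Theorems.Transplant

open MeasureTheory Literature.Probability.Percolation Literature.Probability.LatticeModels SimpleGraph
open scoped Classical

namespace SqShadow

variable {V : Type} {G : SimpleGraph V} (Ψ : SqShadow G) [Countable V]

/-- **For an INJECTIVE shadow the event `𝒳 = A ∩ B⁻ ∩ B⁺ ∩ Cᶜ` contains no lattice configuration** (data in range): by the crossing step
(`exists_mem_γcols`) one of the open self-avoiding paths realising `B⁻`, `B⁺` has a vertex on a column of `γ_min(ω)`; injectivity makes it a vertex of
`γ_min(ω)`, joined to `\overline{S'}` inside `\overline{B'}` by the initial segment of that path, whence `C` (`evC_of_mem_γmin_of_joined`).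
[cite: DuminilCopinSidoraviciusTassion2016, §2.3 (proof of Fact 1, p. 6)] -/
theorem not_mem_evX_of_injective (hinj : Function.Injective Ψ.sh) (D : GlueData) (hD : Ψ.InRange D) {ω : BondConfig V} (hω : ω ⊆ G.edgeSet) :
    ω ∉ Ψ.evX D := by
  intro hX
  have hA : ω ∈ Ψ.glueA D.m D.u₃ D.a D.s := hX.1.1.1
  have hBm : ω ∈ Ψ.glueBm D.m D.u₁ D.a D.s := hX.1.1.2
  have hBp : ω ∈ Ψ.glueBp D.m D.u₁ D.a D.s := hX.1.2
  have hC : ω ∉ Ψ.glueC D.m D.u₃ D.u₁ D.s := hX.2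
  rw [glueBm_eq] at hBm
  rw [glueBp_eq] at hBp
  obtain ⟨πm, hπm⟩ := (mem_openCrossing_iff_exists_openSAP _ _ _ _).1 hBm
  obtain ⟨πp, hπp⟩ := (mem_openCrossing_iff_exists_openSAP _ _ _ _).1 hBp
  obtain ⟨x, hx, w, hw, hwx⟩ := Ψ.exists_mem_γcols D hD hω subset_rfl hX hπm hπp
  obtain rfl : w = x := hinj hwx
  have key : ∀ {Y : Set V} {π : List V}, OpenSAP ω (Ψ.lift (Ψ.small D)) (Ψ.lift (Ψ.src' D)) Y π → w ∈ π → False := fun hπ hmem =>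
    hC (Ψ.evC_of_mem_γmin_of_joined D hA hw (hπ.head_mem hπ.ne_nil) (openConnIn_reverse (hπ.openConnIn_of_mem hmem)))
  rcases hx with hx | hx
  · exact key hπm hx
  · exact key hπp hx

/-- **The routing node holds VACUOUSLY for an injective shadow** (`r = N₀ = m₀ = 0`: there is no lattice configuration in `𝒳` to route).
[cite: DuminilCopinSidoraviciusTassion2016, §2.3 (proof of Fact 2, pp. 6–7)] -/
theorem sqLocatedSurgeries_of_injective (hinj : Function.Injective Ψ.sh) : Ψ.SqLocatedSurgeries :=
  ⟨0, 0, 0, fun D _ hD _ hω hX => (Ψ.not_mem_evX_of_injective hinj D hD hω hX).elim⟩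

/-- **DST's Gluing Lemma for an injective (planar) squareal shadow** — from the vacuous routing node through the chain of record
(`sqGluing_of_locatedSurgeries`: Fact 1 proved, Fact 2 from located surgeries, Lemma 6 from the facts). [cite: DuminilCopinSidoraviciusTassion2016, Lemma 6] -/
theorem sqGluing_of_injective (hinj : Function.Injective Ψ.sh) : Ψ.SqGluing :=
  Ψ.sqGluing_of_locatedSurgeries (Ψ.sqLocatedSurgeries_of_injective hinj)

/-- **`θ_v(p_c) = 0` FOR EVERY CONNECTED GRAPH WITH AN INJECTIVE HEXAGONAL SHADOW and a.s. uniqueness of the infinite cluster** (Duminil-Copin–Sidoravicius–Tassion's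
Theorem 1 transplanted to squareal symmetry, planar case: eq. (1), Lemmata 4–7, eqs. (10)–(13), §2.2, the finite-size criterion and Fact 1 are PROVED in the tree
for every squareal shadow; the surgery of Fact 2 is not needed).  Customers: the dice lattice `F_2` (below), kagome-type planar lattices drawn on `𝕋` with the point
group `D₆` about a square centre acting by graph automorphisms. [cite: DuminilCopinSidoraviciusTassion2016, Thm. 1 and §2] [cite: BenjaminiSchramm1996, Conj. 4 / Question 3] -/
theorem theta_criticalProb_eq_zero_of_injective (hG : G.Connected)
    (hU : ∀ p : unitInterval, ∀ᵐ ω ∂(bondPercolation G p), numInfiniteClusters ω ≤ 1) (hinj : Function.Injective Ψ.sh) (v : V) :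
    theta G v (criticalProbIOf G v) = 0 :=
  Ψ.theta_criticalProb_eq_zero_of_sqGluing hG hU (Ψ.sqGluing_of_injective hinj) v

end SqShadow

end Summit.CriticalPhenomena.PercolationContinuityZ3.Theorems.Transplant

end
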